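import Summits.KontsevichZagierPeriods.KontsevichZagierPeriods.Theses.TerasomaMultiplication
import Summits.KontsevichZagierPeriods.KontsevichZagierPeriods.Theorems.TerasomaMultiplicationMultiplicationAccessibleCornerStokesV
import Summits.KontsevichZagierPeriods.KontsevichZagierPeriods.Theorems.TerasomaMultiplicationMultiplicationAccessibleRotationAverage
import Literature.NumberTheory.Transcendental.SemialgebraicRpow
import Literature.NumberTheory.Transcendental.SemialgebraicLineDeriv
import Literature.NumberTheory.Transcendental.KZLogCalculusProofs

/-!
# `MultiplicationAccessible` (stmt-KontsevichZagierPeriods-12305), line `shifted-family-prime-sieve`: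
the corner Stokes graph package, I — the division spelling of the graph density

For the Liouville rotation flow at `p = 3` (corner Stokes on `W = U × (0,1)_v`, `U` the corner
blow-up chart domain of the cube, `t_k = 1 − yθ_k`), the graph density of the landed chart move
`blowupChartThree` is `GD(u) = G(t(u))·y²` with
`G t = (1 + t₀/ζ + t₀t₁/ζ²)/3 · ∏_{k<3} t_k^(x+k/3−1) (1 − t_k)^(s−1)`, `ζ = (t₀t₁t₂)^(1/3)`.
Pure real-`rpow` book-keeping gives the "division spelling"

  `G(t(w))·y² = (1/3)·y^(3s−1)·K·(M₀/t₀ + M₁/t₁ + M₂/t₂)`,  `H·(1 − Z) = y`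

(`cornerGraphSpelling`, registered sub-goal), where `K = (θ₀θ₁θ₂)^(s−1)`,
`M₀ = t₀^x t₁^(x−2/3) t₂^(x−1/3)`, `M₁`, `M₂` its rotations, `Z = ζ`, `S` the polynomial with
`y·S = 1 − t₀t₁t₂`, `H = (1 + Z + Z²)/S`. The helper lemmas (namespace `CornerGraph`) are reused
by the sibling files (the `v`-derivative of `c₃` and the two representations).
References: Kontsevich–Zagier 2001 §1.2; Andrews–Askey–Roy 1999 pp. 30–31 (Gauss multiplication).
-/

noncomputable section

open MeasureTheory Set Real
open scoped BigOperators

namespace Summit.KontsevichZagierPeriods.TerasomaMultiplication.MultiplicationAccessible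

namespace CornerGraph

/-- Exponent book-keeping `t^p / t^q = t^r` for `p − q = r`, `t > 0`. [folklore] -/
theorem rpow_div_eq {t : ℝ} (ht : 0 < t) {p q r : ℝ} (h : p - q = r) : t ^ p / t ^ q = t ^ r := by
  rw [← h, rpow_sub ht]

/-- `(t^(1/3))² = t^(2/3)` for `t ≥ 0`. [folklore] -/
theorem cbrt_sq {t : ℝ} (ht : 0 ≤ t) : (t ^ ((1:ℝ)/3)) ^ 2 = t ^ ((2:ℝ)/3) := by
  rw [← rpow_natCast, ← rpow_mul ht]; norm_num

/-- **The rotation-averaged shifted integrand without divisions**: for positive `t₀, t₁, t₂`,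
`G t = (1/3)·(t₀^(x−1)t₁^(x−2/3)t₂^(x−1/3) + t₀^(x−1/3)t₁^(x−1)t₂^(x−2/3) + t₀^(x−2/3)t₁^(x−1/3)t₂^(x−1))
· ∏(1 − t_k)^(s−1)` (`t₀/ζ` and `t₀t₁/ζ²` rotate the exponents `(x−1, x−2/3, x−1/3)`).
[cite: AndrewsAskeyRoy1999, Thm 1.5.2] -/
theorem graph_apply (x s : ℚ) {G : (Fin 3 → ℝ) → ℝ}
    (hG : ∀ t : Fin 3 → ℝ, G t = (1 + t 0 / (t 0 * t 1 * t 2) ^ ((1:ℝ)/3) +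
      t 0 * t 1 / ((t 0 * t 1 * t 2) ^ ((1:ℝ)/3)) ^ 2) / 3 *
      ∏ k : Fin 3, (t k) ^ ((x:ℝ) + ((k:ℕ):ℝ) / 3 - 1) * (1 - t k) ^ ((s:ℝ) - 1))
    {t : Fin 3 → ℝ} (h0 : 0 < t 0) (h1 : 0 < t 1) (h2 : 0 < t 2) :
    G t = 1/3 * (t 0 ^ ((x:ℝ) - 1) * t 1 ^ ((x:ℝ) - 2/3) * t 2 ^ ((x:ℝ) - 1/3) +
        t 0 ^ ((x:ℝ) - 1/3) * t 1 ^ ((x:ℝ) - 1) * t 2 ^ ((x:ℝ) - 2/3) +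
        t 0 ^ ((x:ℝ) - 2/3) * t 1 ^ ((x:ℝ) - 1/3) * t 2 ^ ((x:ℝ) - 1)) *
      ((1 - t 0) ^ ((s:ℝ) - 1) * (1 - t 1) ^ ((s:ℝ) - 1) * (1 - t 2) ^ ((s:ℝ) - 1)) := by
  rw [hG, Rotation.shifted_apply, show (x:ℝ) + 1/3 - 1 = (x:ℝ) - 2/3 by ring,
    show (x:ℝ) + 2/3 - 1 = (x:ℝ) - 1/3 by ring]
  set u0 := (1 - t 0) ^ ((s:ℝ) - 1)
  set u1 := (1 - t 1) ^ ((s:ℝ) - 1)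
  set u2 := (1 - t 2) ^ ((s:ℝ) - 1)
  set a := t 0 ^ ((1:ℝ)/3) with ha
  set b := t 1 ^ ((1:ℝ)/3) with hb
  set c := t 2 ^ ((1:ℝ)/3) with hc
  have hζ : (t 0 * t 1 * t 2) ^ ((1:ℝ)/3) = a * b * c := by
    rw [mul_rpow (by positivity) h2.le, mul_rpow h0.le h1.le]
  rw [hζ]
  -- one base at a time
  have hx0 : t 0 * t 0 ^ ((x:ℝ) - 1) = t 0 ^ (x:ℝ) := by
    rw [mul_comm, ← rpow_add_one h0.ne', sub_add_cancel]
  have ha2 : a ^ 2 = t 0 ^ ((2:ℝ)/3) := cbrt_sq h0.le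
  have hb2 : b ^ 2 = t 1 ^ ((2:ℝ)/3) := cbrt_sq h1.le
  have hc2 : c ^ 2 = t 2 ^ ((2:ℝ)/3) := cbrt_sq h2.le
  have f0 : t 0 * t 0 ^ ((x:ℝ) - 1) / a = t 0 ^ ((x:ℝ) - 1/3) := by
    rw [hx0, ha]; exact rpow_div_eq h0 (by ring)
  have f1 : t 1 ^ ((x:ℝ) - 2/3) / b = t 1 ^ ((x:ℝ) - 1) := rpow_div_eq h1 (by ring)
  have f2 : t 2 ^ ((x:ℝ) - 1/3) / c = t 2 ^ ((x:ℝ) - 2/3) := rpow_div_eq h2 (by ring)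
  have g0 : t 0 * t 0 ^ ((x:ℝ) - 1) / a ^ 2 = t 0 ^ ((x:ℝ) - 2/3) := by
    rw [hx0, ha2]; exact rpow_div_eq h0 (by ring)
  have g1 : t 1 * t 1 ^ ((x:ℝ) - 2/3) / b ^ 2 = t 1 ^ ((x:ℝ) - 1/3) := by
    rw [mul_comm (t 1), ← rpow_add_one h1.ne', hb2]; exact rpow_div_eq h1 (by ring)
  have g2 : t 2 ^ ((x:ℝ) - 1/3) / c ^ 2 = t 2 ^ ((x:ℝ) - 1) := by
    rw [hc2]; exact rpow_div_eq h2 (by ring)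
  have hapos : 0 < a := rpow_pos_of_pos h0 _
  have hbpos : 0 < b := rpow_pos_of_pos h1 _
  have hcpos : 0 < c := rpow_pos_of_pos h2 _
  have ha0 : a ≠ 0 := hapos.ne'
  have hb0 : b ≠ 0 := hbpos.ne'
  have hc0 : c ≠ 0 := hcpos.ne'
  have k1 : t 0 / (a * b * c) * (t 0 ^ ((x:ℝ) - 1) * t 1 ^ ((x:ℝ) - 2/3) * t 2 ^ ((x:ℝ) - 1/3)) =
      t 0 ^ ((x:ℝ) - 1/3) * t 1 ^ ((x:ℝ) - 1) * t 2 ^ ((x:ℝ) - 2/3) := by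
    rw [← f0, ← f1, ← f2]
    field_simp
  have k2 : t 0 * t 1 / (a * b * c) ^ 2 *
      (t 0 ^ ((x:ℝ) - 1) * t 1 ^ ((x:ℝ) - 2/3) * t 2 ^ ((x:ℝ) - 1/3)) =
      t 0 ^ ((x:ℝ) - 2/3) * t 1 ^ ((x:ℝ) - 1/3) * t 2 ^ ((x:ℝ) - 1) := by
    rw [← g0, ← g1, ← g2]
    field_simp
  linear_combination (1/3 * (u0 * u1 * u2)) * (k1 + k2)

/-- A product of three real powers with bases in `[0,1]` and non-negative exponents lies in
`[0,1]`. [folklore] -/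
theorem triple_rpow_mem {t0 t1 t2 e0 e1 e2 : ℝ} (h0 : 0 ≤ t0) (h0' : t0 ≤ 1) (h1 : 0 ≤ t1)
    (h1' : t1 ≤ 1) (h2 : 0 ≤ t2) (h2' : t2 ≤ 1) (he0 : 0 ≤ e0) (he1 : 0 ≤ e1) (he2 : 0 ≤ e2) :
    0 ≤ t0 ^ e0 * t1 ^ e1 * t2 ^ e2 ∧ t0 ^ e0 * t1 ^ e1 * t2 ^ e2 ≤ 1 :=
  ⟨by positivity, mul_le_one₀ (mul_le_one₀ (rpow_le_one h0 h0' he0) (rpow_nonneg h1 _)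
    (rpow_le_one h1 h1' he1)) (rpow_nonneg h2 _) (rpow_le_one h2 h2' he2)⟩

/-- On the chart domain the box coordinates `t_k = 1 − yθ_k` lie in `(0,1)`. [folklore] -/
theorem t_mem {a b y : ℝ} (ha : 0 < a) (hb : 0 < b) (hab : a + b < 1) (hy : 0 < y)
    (h0 : y * (1 - a - b) < 1) (h1 : y * a < 1) (h2 : y * b < 1) :
    (0 < 1 - y * (1 - a - b) ∧ 1 - y * (1 - a - b) < 1) ∧ (0 < 1 - y * a ∧ 1 - y * a < 1) ∧
      (0 < 1 - y * b ∧ 1 - y * b < 1) := by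
  have h0' : 0 < y * (1 - a - b) := mul_pos hy (by linarith)
  have h1' : 0 < y * a := mul_pos hy ha
  have h2' : 0 < y * b := mul_pos hy hb
  exact ⟨⟨by linarith, by linarith⟩, ⟨by linarith, by linarith⟩, ⟨by linarith, by linarith⟩⟩

/-- **The graph density on the chart, without divisions**: with `t = (1 − yθ₀, 1 − yθ₁, 1 − yθ₂)`,
`G(t)·y² = (1/3)·y^(3s−1)·(θ₀θ₁θ₂)^(s−1)·(t₀^(x−1)t₁^(x−2/3)t₂^(x−1/3) + t₀^(x−1/3)t₁^(x−1)t₂^(x−2/3)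
+ t₀^(x−2/3)t₁^(x−1/3)t₂^(x−1))` (`1 − t_k = yθ_k`). [cite: KontsevichZagier2001, §1.2] -/
theorem graph_chart (x s : ℚ) {G : (Fin 3 → ℝ) → ℝ}
    (hG : ∀ t : Fin 3 → ℝ, G t = (1 + t 0 / (t 0 * t 1 * t 2) ^ ((1:ℝ)/3) +
      t 0 * t 1 / ((t 0 * t 1 * t 2) ^ ((1:ℝ)/3)) ^ 2) / 3 *
      ∏ k : Fin 3, (t k) ^ ((x:ℝ) + ((k:ℕ):ℝ) / 3 - 1) * (1 - t k) ^ ((s:ℝ) - 1))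
    {a b y : ℝ} (ha : 0 < a) (hb : 0 < b) (hab : a + b < 1) (hy : 0 < y)
    (h0 : y * (1 - a - b) < 1) (h1 : y * a < 1) (h2 : y * b < 1) :
    G ![1 - y * (1 - a - b), 1 - y * a, 1 - y * b] * y ^ 2 =
      1/3 * y ^ (3 * (s:ℝ) - 1) * ((1 - a - b) * a * b) ^ ((s:ℝ) - 1) *
        ((1 - y * (1 - a - b)) ^ ((x:ℝ) - 1) * (1 - y * a) ^ ((x:ℝ) - 2/3) *
            (1 - y * b) ^ ((x:ℝ) - 1/3) +
          (1 - y * (1 - a - b)) ^ ((x:ℝ) - 1/3) * (1 - y * a) ^ ((x:ℝ) - 1) *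
            (1 - y * b) ^ ((x:ℝ) - 2/3) +
          (1 - y * (1 - a - b)) ^ ((x:ℝ) - 2/3) * (1 - y * a) ^ ((x:ℝ) - 1/3) *
            (1 - y * b) ^ ((x:ℝ) - 1)) := by
  obtain ⟨⟨ht0, -⟩, ⟨ht1, -⟩, ⟨ht2, -⟩⟩ := t_mem ha hb hab hy h0 h1 h2
  have e0 : (![1 - y * (1 - a - b), 1 - y * a, 1 - y * b] : Fin 3 → ℝ) 0 = 1 - y * (1 - a - b) :=
    rfl
  have e1 : (![1 - y * (1 - a - b), 1 - y * a, 1 - y * b] : Fin 3 → ℝ) 1 = 1 - y * a := rfl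
  have e2 : (![1 - y * (1 - a - b), 1 - y * a, 1 - y * b] : Fin 3 → ℝ) 2 = 1 - y * b := rfl
  rw [graph_apply x s hG (t := ![1 - y * (1 - a - b), 1 - y * a, 1 - y * b]) (by rw [e0]; exact ht0)
    (by rw [e1]; exact ht1) (by rw [e2]; exact ht2), e0, e1, e2, sub_sub_cancel, sub_sub_cancel,
    sub_sub_cancel]
  have hθ0 : 0 < 1 - a - b := by linarith
  -- `(yθ)^(s-1) = y^(s-1) θ^(s-1)` and `y^(s-1)³ · y² = y^(3s-1)`
  rw [mul_rpow hy.le hθ0.le, mul_rpow hy.le ha.le, mul_rpow hy.le hb.le,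
    mul_rpow (mul_pos hθ0 ha).le hb.le, mul_rpow hθ0.le ha.le]
  have hy3 : y ^ (3 * (s:ℝ) - 1) = y ^ ((s:ℝ) - 1) * y ^ ((s:ℝ) - 1) * y ^ ((s:ℝ) - 1) * y ^ 2 := by
    rw [← rpow_natCast y 2, ← rpow_add hy, ← rpow_add hy, ← rpow_add hy]
    congr 1
    push_cast
    ring
  rw [hy3]
  ring

/-- The polynomial identity `y·S = 1 − t₀t₁t₂` behind `H(1 − Z) = y` (`θ₀ + θ₁ + θ₂ = 1`). [folklore] -/
theorem y_mul_S (a b y : ℝ) :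
    y * (1 - y * ((1 - a - b) * a + (1 - a - b) * b + a * b) + y ^ 2 * ((1 - a - b) * a * b)) =
      1 - (1 - y * (1 - a - b)) * (1 - y * a) * (1 - y * b) := by
  ring

/-- **`H·(1 − Z) = y` on the chart domain**: `(1 + Z + Z²)(1 − Z) = 1 − Z³ = 1 − t₀t₁t₂ = y·S`
and `S > 0`. [cite: KontsevichZagier2001, §1.2] -/
theorem H_mul_one_sub_Z {a b y Z S : ℝ} (ha : 0 < a) (hb : 0 < b) (hab : a + b < 1) (hy : 0 < y)
    (h0 : y * (1 - a - b) < 1) (h1 : y * a < 1) (h2 : y * b < 1)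
    (hZ : Z = ((1 - y * (1 - a - b)) * (1 - y * a) * (1 - y * b)) ^ ((1:ℝ)/3))
    (hS : S = 1 - y * ((1 - a - b) * a + (1 - a - b) * b + a * b) + y ^ 2 * ((1 - a - b) * a * b)) :
    0 < S ∧ (1 + Z + Z ^ 2) / S * (1 - Z) = y := by
  obtain ⟨⟨ht0, ht0'⟩, ⟨ht1, ht1'⟩, ⟨ht2, ht2'⟩⟩ := t_mem ha hb hab hy h0 h1 h2
  have hprod : (1 - y * (1 - a - b)) * (1 - y * a) * (1 - y * b) < 1 := by
    calc (1 - y * (1 - a - b)) * (1 - y * a) * (1 - y * b) < 1 * 1 * 1 := by gcongr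
      _ = 1 := by ring
  have hyS : y * S = 1 - (1 - y * (1 - a - b)) * (1 - y * a) * (1 - y * b) := by
    rw [hS]; exact y_mul_S a b y
  have hSpos : 0 < S := by
    have : 0 < y * S := by rw [hyS]; linarith
    exact pos_of_mul_pos_right this hy.le
  have hZ3 : Z ^ 3 = (1 - y * (1 - a - b)) * (1 - y * a) * (1 - y * b) := by
    rw [hZ, ← rpow_natCast, ← rpow_mul (by positivity)]; norm_num
  refine ⟨hSpos, ?_⟩
  rw [div_mul_eq_mul_div, div_eq_iff hSpos.ne']
  linear_combination (-1 : ℝ) * hZ3 - hyS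

/-- **AM–GM on the chart**: `ζ = (t₀t₁t₂)^(1/3) ≤ (t₀ + t₁ + t₂)/3 = 1 − y/3`. [folklore] -/
theorem zeta_le {a b y : ℝ} (ha : 0 < a) (hb : 0 < b) (hab : a + b < 1) (hy : 0 < y)
    (h0 : y * (1 - a - b) < 1) (h1 : y * a < 1) (h2 : y * b < 1) :
    ((1 - y * (1 - a - b)) * (1 - y * a) * (1 - y * b)) ^ ((1:ℝ)/3) ≤ 1 - y / 3 := by
  obtain ⟨⟨ht0, -⟩, ⟨ht1, -⟩, ⟨ht2, -⟩⟩ := t_mem ha hb hab hy h0 h1 h2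
  rw [mul_rpow (by positivity) ht2.le, mul_rpow ht0.le ht1.le]
  have h := geom_mean_le_arith_mean3_weighted (w₁ := 1/3) (w₂ := 1/3) (w₃ := 1/3)
    (by norm_num) (by norm_num) (by norm_num) ht0.le ht1.le ht2.le (by norm_num)
  linarith

end CornerGraph

/-- **The division spelling of the graph density** (registered sub-goal `cornerGraphSpelling` of
`stub_gmThreeShifted`): on `W`, with `t = (1 − yθ₀, 1 − yθ₁, 1 − yθ₂)`, `y = w 2`,
`G(t)·y² = (1/3)·y^(3s−1)·K·(M₀/t₀ + M₁/t₁ + M₂/t₂)` and `H·(1 − Z) = y`. Pure `rpow`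
book-keeping: `(t₀t₁t₂)^(1/3) = ∏ t_k^(1/3)`, `1 − t_k = yθ_k`, `y·S = 1 − Z³`.
[cite: KontsevichZagier2001, §1.2] -/
theorem cornerGraphSpelling : ∀ (x s : ℚ), 2 ≤ x → 3 ≤ s → ∀ (Z S H K M0 M1 M2 P : (Fin 4 → ℝ) → ℝ),
    (∀ w, Z w = ((1 - w 2 * (1 - w 0 - w 1)) * (1 - w 2 * w 0) * (1 - w 2 * w 1)) ^ ((1:ℝ)/3)) →
    (∀ w, S w = 1 - w 2 * ((1 - w 0 - w 1) * w 0 + (1 - w 0 - w 1) * w 1 + w 0 * w 1) +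
      (w 2) ^ 2 * ((1 - w 0 - w 1) * w 0 * w 1)) →
    (∀ w, H w = (1 + Z w + Z w ^ 2) / S w) →
    (∀ w, K w = ((1 - w 0 - w 1) * w 0 * w 1) ^ ((s:ℝ) - 1)) →
    (∀ w, M0 w = (1 - w 2 * (1 - w 0 - w 1)) ^ (x:ℝ) * (1 - w 2 * w 0) ^ ((x:ℝ) - 2/3) * (1 - w 2 * w 1) ^ ((x:ℝ) - 1/3)) →
    (∀ w, M1 w = (1 - w 2 * (1 - w 0 - w 1)) ^ ((x:ℝ) - 1/3) * (1 - w 2 * w 0) ^ (x:ℝ) * (1 - w 2 * w 1) ^ ((x:ℝ) - 2/3)) →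
    (∀ w, M2 w = (1 - w 2 * (1 - w 0 - w 1)) ^ ((x:ℝ) - 2/3) * (1 - w 2 * w 0) ^ ((x:ℝ) - 1/3) * (1 - w 2 * w 1) ^ (x:ℝ)) →
    (∀ w, P w = (w 3) ^ (3 * (x:ℝ) - 1) * (1 - w 3 * Z w) ^ (3 * (s:ℝ) - 1) * H w ^ (3 * (s:ℝ)) * K w) →
    ∀ (G : (Fin 3 → ℝ) → ℝ), (∀ t : Fin 3 → ℝ, G t = (1 + t 0 / (t 0 * t 1 * t 2) ^ ((1:ℝ)/3) +
      t 0 * t 1 / ((t 0 * t 1 * t 2) ^ ((1:ℝ)/3)) ^ 2) / 3 *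
      ∏ k : Fin 3, (t k) ^ ((x:ℝ) + ((k:ℕ):ℝ) / 3 - 1) * (1 - t k) ^ ((s:ℝ) - 1)) →
    ∀ w ∈ {w : Fin 4 → ℝ | 0 < w 0 ∧ 0 < w 1 ∧ w 0 + w 1 < 1 ∧ 0 < w 2 ∧ w 2 * (1 - w 0 - w 1) < 1 ∧ w 2 * w 0 < 1 ∧ w 2 * w 1 < 1 ∧ 0 < w 3 ∧ w 3 < 1},
      G ![1 - w 2 * (1 - w 0 - w 1), 1 - w 2 * w 0, 1 - w 2 * w 1] * (w 2) ^ 2 =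
        1/3 * (w 2) ^ (3 * (s:ℝ) - 1) * K w * (M0 w / (1 - w 2 * (1 - w 0 - w 1)) + M1 w / (1 - w 2 * w 0) + M2 w / (1 - w 2 * w 1)) ∧
      H w * (1 - Z w) = w 2 := by
  intro x s _ _ Z S H K M0 M1 M2 P hZ hS hH hK hM0 hM1 hM2 _ G hG w hw
  obtain ⟨h0, h1, h01, hy, ha, hb, hc, -, -⟩ := hw
  obtain ⟨⟨ht0, -⟩, ⟨ht1, -⟩, ⟨ht2, -⟩⟩ := CornerGraph.t_mem h0 h1 h01 hy ha hb hc
  refine ⟨?_, ?_⟩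
  · rw [CornerGraph.graph_chart x s hG h0 h1 h01 hy ha hb hc, hK, hM0, hM1, hM2,
      rpow_sub_one ht0.ne' (x:ℝ), rpow_sub_one ht1.ne' (x:ℝ), rpow_sub_one ht2.ne' (x:ℝ)]
    ring
  · rw [hH]
    exact (CornerGraph.H_mul_one_sub_Z h0 h1 h01 hy ha hb hc (hZ w) (hS w)).2

end Summit.KontsevichZagierPeriods.TerasomaMultiplication.MultiplicationAccessible

end
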